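import Summits.FinalStateConjecture.FinalStateConjecture.Theses.ExactKerrEnds
import Summits.FinalStateConjecture.FinalStateConjecture.Theorems.ExactKerrEndsTrivialDatumWitness
import Summits.FinalStateConjecture.FinalStateConjecture.Theorems.PhaseMixingCaptureCaptureSufficesC2DiagonalReduction
import Literature.Geometry.Lorentzian.TameBreathingCurve
import Literature.Geometry.Lorentzian.TameGenericityDiagonal
import HarnessLib

/-!
# Crux `ExactKerrEnds.CensorshipAlongKerrEnds` (stmt-FinalStateConjecture-18521) against the summit:
# what part of C₁ is summit-necessary and what part is the route's own excess

`C₁ = CensorshipAlongKerrEnds` (route ExactKerrEnds, rank 3): along every tame curve `F` of admissible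
data whose members off `0` are KERR-ENDED (immersed-injective, or constant) there is a tame injective
immersed admissible curve `F'` with `F' 0 = F 0` whose members off `0` are KERR-ENDED ∧ CENSORED.

Write `Censored D := ∀ 𝒟, 𝒟.IsMaximal → HasCompleteNullInfinity 𝒟.toCauchyDevelopment` and
`TameWCC X := IsTameChristodoulouGeneric (admissibleVacuumData X) (fun D ↦ (∃ MGHD of D) ∧ Censored D) 1`
(the body of item stmt-FinalStateConjecture-17269 `PhaseMixingCapture.WeakCosmicCensorshipTame`, the
WEAK-COSMIC-CENSORSHIP HALF of the re-typed summit, necessary for it: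
`tameCensorship_of_finalStateConjecture`). This file kernel-checks the position of `C₁`:

* `censoredSelfWitness` — through every admissible CENSORED datum passes a tame injective immersed
  admissible curve ALL of whose members are censored (breathing curve + `censored_breatheFamily`).
* `censoredEscape_of_tameWCC` — **`TameWCC` already gives `C₁` with the word "Kerr-ended" deleted from
  the CONCLUSION** (and from the hypotheses: through EVERY admissible datum passes a tame injective
  immersed admissible curve whose members off `0` are censored). Hence (`…_of_finalStateConjecture`) so
  does the summit itself.
* `tameWCC_of_routeItems` — conversely `E ∧ C₁ ∧ M` (this route's ranks 4, 3, 5) imply `TameWCC`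
  (step 1 of the route's `closes` + monotonicity).

So the ENTIRE distance between `C₁` and a consequence of the summit is the requirement that the
censored escape members be KERR-ENDED — which the route's `closes` genuinely needs (they are the input
curves of `C₂`), and which the summit does NOT supply: `FinalStateConjecture` constrains only
tame-generic data and is silent on the (infinite-codimension) Kerr-ended class, so — informally, not
kernel-checkable without a model — `S ∧ E ∧ M ⊬ C₁`, whereas `S → C₂` is landed
(`settlingAlongCensoredKerrEnds_of_finalStateConjecture`). In the registered line `Sketch`
(transplant-the-end) this excess is exactly the pair of private stubs `stub_recedingKerrGluing`
(Kerr-end the censored escape: parametric Corvino–Schoen) + `stub_lateAbsorption` (censoredness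
survives the Kerr-ending). Nothing dynamical is claimed here. [folklore]
-/

set_option linter.dupNamespace false

noncomputable section

open Set Function Filter TopologicalSpace
open scoped Manifold ContDiff Topology

namespace Summit.FinalStateConjecture.FinalStateConjecture.Theorems.ExactKerrEnds

open Literature.Geometry.Lorentzian
open Summit.FinalStateConjecture (HasCompleteNullInfinity)
open Summit.FinalStateConjecture.FinalStateConjecture.Theses.ExactKerrEnds
  (CensorshipAlongKerrEnds TameEscapeToKerrEnds MGHDExists)

/-! ### Censored self-witnesses -/

section SelfWitness

variable {X : Type} [TopologicalSpace X] [ChartedSpace E3 X] [IsManifold (𝓡 3) ∞ X]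
  [T2Space X] [SecondCountableTopology X] [ConnectedSpace X]

/-- **Self-witnesses of censoredness.** Through every admissible datum `d` which is censored (every
maximal vacuum Cauchy development has complete `𝓘⁺`) passes a tame (on a collared restriction of the
sole end of `d`), injective, immersed curve of admissible data EVERY member of which is censored: the
breathing curve of `d` (its members are re-indexings `Φ_c^* d` of `d` by diffeomorphisms, and
censoredness is transported along them, `censored_breatheFamily`). [cite: Christodoulou1999, p. A24] -/
theorem censoredSelfWitness {d : InitialDataSet (𝓡 3) X} (hd : d ∈ admissibleVacuumData X)
    (hC : ∀ 𝒟 : VacuumCauchyDevelopment d, 𝒟.IsMaximal → HasCompleteNullInfinity 𝒟.toCauchyDevelopment) :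
    ∃ (e' : AFEnd X) (F' : EuclideanSpace ℝ (Fin 1) → InitialDataSet (𝓡 3) X),
      InitialDataSet.IsTameDataFamily e' 1 F' ∧ F' 0 = d ∧ Injective F' ∧
        InitialDataSet.IsImmersedAtZero 1 F' ∧ (∀ c, F' c ∈ admissibleVacuumData X) ∧
          ∀ (c : EuclideanSpace ℝ (Fin 1)) (𝒟 : VacuumCauchyDevelopment (F' c)), 𝒟.IsMaximal →
            HasCompleteNullInfinity 𝒟.toCauchyDevelopment := by
  obtain ⟨-, e₀, M, hsole, hdecay⟩ := id hd
  set z₀ : E3 := (e₀.R + 3) • EuclideanSpace.single (0 : Fin 3) (1 : ℝ) with hz₀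
  have hz₀n : ‖z₀‖ = e₀.R + 3 := by
    rw [hz₀, norm_smul, PiLp.norm_single, norm_one, mul_one,
      Real.norm_of_nonneg (by linarith [e₀.R_pos])]
  have B : e₀.BreathingData z₀ 1 := ⟨one_pos, by rw [hz₀n]; linarith⟩
  have hR₁ : e₀.R < e₀.R + 1 := by linarith
  exact ⟨e₀.restrict hR₁.le, fun c ↦ AFEnd.breatheFamily B d (c 0),
    AFEnd.isTameDataFamily_restrict_breatheCurve B d hsole hdecay hR₁,
    AFEnd.breatheCurve_zero B d, AFEnd.injective_breatheCurve B d,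
    AFEnd.isImmersedAtZero_breatheCurve B d,
    fun c ↦ AFEnd.breatheCurve_mem_admissibleVacuumData B d hd c,
    fun c ↦ censored_breatheFamily B d (c 0) hC⟩

end SelfWitness

/-! ### `C₁` with "Kerr-ended" deleted from the conclusion is summit-necessary -/

/-- **Censored tame escapes through EVERY admissible datum, from tame weak cosmic censorship.** If
`(∃ MGHD) ∧ Censored` is tame-Christodoulou-generic in `admissibleVacuumData X` (the body of item
stmt-FinalStateConjecture-17269 `WeakCosmicCensorshipTame`), then through every admissible datum `d` passes
a tame, injective, immersed curve of admissible data whose members off `0` are censored: the genericity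
witness if `d` is exceptional, the censored self-witness (`censoredSelfWitness`) otherwise. This is
`CensorshipAlongKerrEnds` with the Kerr-endedness of the OUTPUT members deleted (and every hypothesis on
the input curve but `F 0 ∈ 𝓓` dropped). [folklore] -/
theorem censoredEscape_of_tameWCC
    (h : ∀ (X : Type) [TopologicalSpace X] [ChartedSpace E3 X] [IsManifold (𝓡 3) ∞ X] [T2Space X]
      [SecondCountableTopology X] [ConnectedSpace X],
      InitialDataSet.IsTameChristodoulouGeneric (admissibleVacuumData X)
        (fun D ↦ (∃ 𝒟 : VacuumCauchyDevelopment D, 𝒟.IsMaximal) ∧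
          ∀ 𝒟 : VacuumCauchyDevelopment D, 𝒟.IsMaximal →
            Summit.FinalStateConjecture.HasCompleteNullInfinity 𝒟.toCauchyDevelopment) 1) :
    ∀ (X : Type) [TopologicalSpace X] [ChartedSpace E3 X] [IsManifold (𝓡 3) ∞ X] [T2Space X]
      [SecondCountableTopology X] [ConnectedSpace X],
      ∀ d ∈ admissibleVacuumData X,
        ∃ (e' : AFEnd X) (F' : EuclideanSpace ℝ (Fin 1) → InitialDataSet (𝓡 3) X),
          InitialDataSet.IsTameDataFamily e' 1 F' ∧ F' 0 = d ∧ Injective F' ∧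
            InitialDataSet.IsImmersedAtZero 1 F' ∧ (∀ c, F' c ∈ admissibleVacuumData X) ∧
              ∀ c ≠ 0, ∀ 𝒟 : VacuumCauchyDevelopment (F' c), 𝒟.IsMaximal →
                Summit.FinalStateConjecture.HasCompleteNullInfinity 𝒟.toCauchyDevelopment := by
  intro X _ _ _ _ _ _ d hd
  by_cases hP : (∃ 𝒟 : VacuumCauchyDevelopment d, 𝒟.IsMaximal) ∧
      ∀ 𝒟 : VacuumCauchyDevelopment d, 𝒟.IsMaximal →
        Summit.FinalStateConjecture.HasCompleteNullInfinity 𝒟.toCauchyDevelopment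
  · obtain ⟨e', F', hF', h0, hinj, himm, hadm, hC⟩ := censoredSelfWitness hd hP.2
    exact ⟨e', F', hF', h0, hinj, himm, hadm, fun c _ ↦ hC c⟩
  · obtain ⟨e, F, hF, himm, h0, hinj, hadm, hgood⟩ := h X d ⟨hd, hP⟩
    refine ⟨e, F, hF, h0, hinj, himm, hadm, fun c hc ↦ ?_⟩
    have hPc : (∃ 𝒟 : VacuumCauchyDevelopment (F c), 𝒟.IsMaximal) ∧
        ∀ 𝒟 : VacuumCauchyDevelopment (F c), 𝒟.IsMaximal →
          Summit.FinalStateConjecture.HasCompleteNullInfinity 𝒟.toCauchyDevelopment := by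
      by_contra hno
      exact hgood c hc ⟨hadm c, hno⟩
    exact hPc.2


/-- **Registered form (`stub_censoredTameAccess`): CENSORED TAME ACCESS from tame weak cosmic
censorship** — the access step of a transplant-type composition for `C₁` run with the invariant
"censored" in place of "settled" (cf. `settledTameAccess_of_exits` of line `Sketch`): tame weak cosmic
censorship in MGHD form (the body of item stmt-FinalStateConjecture-17269, summit-necessary) already
puts a tame injective immersed admissible curve with censored members off `0` through EVERY admissible
datum; what `C₁` asks beyond it is that these members be Kerr-ended. One-line signature over fully
qualified names (the stub registry reads it verbatim); proof = `censoredEscape_of_tameWCC`. [folklore] -/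
theorem stub_censoredTameAccess : (∀ (X : Type) [TopologicalSpace X] [ChartedSpace Literature.Geometry.Lorentzian.E3 X] [IsManifold (𝓡 3) ((⊤ : ℕ∞) : WithTop ℕ∞) X] [T2Space X] [SecondCountableTopology X] [ConnectedSpace X], Literature.Geometry.Lorentzian.InitialDataSet.IsTameChristodoulouGeneric (Literature.Geometry.Lorentzian.admissibleVacuumData X) (fun D ↦ (∃ 𝒟 : Literature.Geometry.Lorentzian.VacuumCauchyDevelopment D, 𝒟.IsMaximal) ∧ ∀ 𝒟 : Literature.Geometry.Lorentzian.VacuumCauchyDevelopment D, 𝒟.IsMaximal → Summit.FinalStateConjecture.HasCompleteNullInfinity 𝒟.toCauchyDevelopment) 1) → ∀ (X : Type) [TopologicalSpace X] [ChartedSpace Literature.Geometry.Lorentzian.E3 X] [IsManifold (𝓡 3) ((⊤ : ℕ∞) : WithTop ℕ∞) X] [T2Space X] [SecondCountableTopology X] [ConnectedSpace X], ∀ d ∈ Literature.Geometry.Lorentzian.admissibleVacuumData X, ∃ (e' : Literature.Geometry.Lorentzian.AFEnd X) (F' : EuclideanSpace ℝ (Fin 1) → Literature.Geometry.Lorentzian.InitialDataSet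 (𝓡 3) X), Literature.Geometry.Lorentzian.InitialDataSet.IsTameDataFamily e' 1 F' ∧ F' 0 = d ∧ Function.Injective F' ∧ Literature.Geometry.Lorentzian.InitialDataSet.IsImmersedAtZero 1 F' ∧ (∀ c, F' c ∈ Literature.Geometry.Lorentzian.admissibleVacuumData X) ∧ ∀ c ≠ 0, ∀ 𝒟 : Literature.Geometry.Lorentzian.VacuumCauchyDevelopment (F' c), 𝒟.IsMaximal → Summit.FinalStateConjecture.HasCompleteNullInfinity 𝒟.toCauchyDevelopment :=
  fun h ↦ censoredEscape_of_tameWCC h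

/-- **… hence from the summit itself** (`tameCensorship_of_finalStateConjecture`: the re-typed summit
implies tame weak cosmic censorship in MGHD form). [folklore] -/
theorem censoredEscape_of_finalStateConjecture (hS : _root_.FinalStateConjecture) :
    ∀ (X : Type) [TopologicalSpace X] [ChartedSpace E3 X] [IsManifold (𝓡 3) ∞ X] [T2Space X]
      [SecondCountableTopology X] [ConnectedSpace X],
      ∀ d ∈ admissibleVacuumData X,
        ∃ (e' : AFEnd X) (F' : EuclideanSpace ℝ (Fin 1) → InitialDataSet (𝓡 3) X),
          InitialDataSet.IsTameDataFamily e' 1 F' ∧ F' 0 = d ∧ Injective F' ∧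
            InitialDataSet.IsImmersedAtZero 1 F' ∧ (∀ c, F' c ∈ admissibleVacuumData X) ∧
              ∀ c ≠ 0, ∀ 𝒟 : VacuumCauchyDevelopment (F' c), 𝒟.IsMaximal →
                Summit.FinalStateConjecture.HasCompleteNullInfinity 𝒟.toCauchyDevelopment :=
  censoredEscape_of_tameWCC
    (Summit.FinalStateConjecture.FinalStateConjecture.Theorems.PhaseMixingCaptureCaptureSufficesC2.tameCensorship_of_finalStateConjecture
      hS)

/-! ### Conversely: the route's `E ∧ C₁ ∧ M` imply tame weak cosmic censorship -/

/-- **`TameEscapeToKerrEnds ∧ CensorshipAlongKerrEnds ∧ MGHDExists ⟹` tame weak cosmic censorship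
(MGHD form, the body of item stmt-FinalStateConjecture-17269).** Step 1 of the route's `closes`: composing
the tame genericity of Kerr-endedness (`E`) with `C₁` along curves
(`isTameChristodoulouGeneric_of_relative'`) makes "Kerr-ended ∧ censored" tame-generic; forget
Kerr-endedness and re-insert MGHD existence pointwise (`IsTameChristodoulouGeneric.mono`). So this
route's ranks 3–5 sit ABOVE the other routes' weak-cosmic-censorship crux. [folklore] -/
theorem tameWCC_of_routeItems (hE : TameEscapeToKerrEnds) (hC : CensorshipAlongKerrEnds)
    (hM : MGHDExists) :
    ∀ (X : Type) [TopologicalSpace X] [ChartedSpace E3 X] [IsManifold (𝓡 3) ∞ X] [T2Space X]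
      [SecondCountableTopology X] [ConnectedSpace X],
      InitialDataSet.IsTameChristodoulouGeneric (admissibleVacuumData X)
        (fun D ↦ (∃ 𝒟 : VacuumCauchyDevelopment D, 𝒟.IsMaximal) ∧
          ∀ 𝒟 : VacuumCauchyDevelopment D, 𝒟.IsMaximal →
            Summit.FinalStateConjecture.HasCompleteNullInfinity 𝒟.toCauchyDevelopment) 1 := by
  intro X _ _ _ _ _ _
  have h𝓓 : ∀ d ∈ admissibleVacuumData X,
      ∃ e : AFEnd X, e.IsSoleEnd ∧ ∃ M : ℝ, e.IsStronglyAsymptoticallyFlatDR d M := by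
    intro d hd
    obtain ⟨e, M, hs, hM'⟩ := hd.2
    exact ⟨e, hs, M, hM'⟩
  have h1 : Literature.Geometry.Lorentzian.InitialDataSet.IsTameChristodoulouGeneric
      (Literature.Geometry.Lorentzian.admissibleVacuumData X)
      (fun D ↦ (fun D ↦ ∀ [Literature.Geometry.Lorentzian.Kerr.Facts], ∃ (K : Set X) (U : Opens Literature.Geometry.Lorentzian.E3) (M a r₀ : ℝ) (hM : 0 ≤ M) (φ : U → X) (ψ : U → Literature.Geometry.Lorentzian.Kerr.region a r₀) (ν : Literature.Geometry.Lorentzian.NormalField 𝓘(ℝ, Literature.Geometry.Lorentzian.E4) ψ), IsCompact K ∧ Kᶜ ⊆ range φ ∧ Topology.IsOpenEmbedding φ ∧ ContMDiff 𝓘(ℝ, Literature.Geometry.Lorentzian.E3) (𝓡 3) ((⊤ : ℕ∞) : WithTop ℕ∞) φ ∧ Injective ψ ∧ (Literature.Geometry.Lorentzian.Kerr.smoothMetric M a r₀).IsSpacelikeImmersion 𝓘(ℝ, Literature.Geometry.Lorentzian.E3) ψ ∧ (Literature.Geometry.Lorentzian.Kerr.smoothMetric M a r₀).IsFutureUnitNormal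 𝓘(ℝ, Literature.Geometry.Lorentzian.E3) ((Literature.Geometry.Lorentzian.Kerr.timeOrientation M a r₀ hM).ofLE le_top) ψ ν ∧ (∀ (y : U) (v w : Literature.Geometry.Lorentzian.E3), φ y ∉ K → D.h.inner (φ y) (mfderiv 𝓘(ℝ, Literature.Geometry.Lorentzian.E3) (𝓡 3) φ y v) (mfderiv 𝓘(ℝ, Literature.Geometry.Lorentzian.E3) (𝓡 3) φ y w) = Literature.Geometry.Lorentzian.Kerr.bilin M a (ψ y : Literature.Geometry.Lorentzian.E4) (mfderiv 𝓘(ℝ, Literature.Geometry.Lorentzian.E3) 𝓘(ℝ, Literature.Geometry.Lorentzian.E4) ψ y v) (mfderiv 𝓘(ℝ, Literature.Geometry.Lorentzian.E3) 𝓘(ℝ, Literature.Geometry.Lorentzian.E4) ψ y w)) ∧ (∀ [(Literature.Geometry.Lorentzian.Kerr.smoothMetric M a r₀).HasLeviCivita] (y : U) (v w : Literature.Geometry.Lorentzian.E3), φ y ∉ K → D.k (φ y) (mfderiv 𝓘(ℝ, Literature.Geometry.Lorentzian.E3) (𝓡 3) φ y v) (mfderiv 𝓘(ℝ, Literature.Geometry.Lorentzian.E3)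 (𝓡 3) φ y w) = (Literature.Geometry.Lorentzian.Kerr.smoothMetric M a r₀).secondFundamentalForm 𝓘(ℝ, Literature.Geometry.Lorentzian.E3) ψ ν y v w)) D ∧ (fun D ↦ ∀ 𝒟 : Literature.Geometry.Lorentzian.VacuumCauchyDevelopment D, 𝒟.IsMaximal → Summit.FinalStateConjecture.HasCompleteNullInfinity 𝒟.toCauchyDevelopment) D) 1 :=
    Literature.Geometry.Lorentzian.InitialDataSet.isTameChristodoulouGeneric_of_relative'
      h𝓓 (hE X) (hC X)
  exact h1.mono fun D hD hKC ↦ ⟨hM X D hD, hKC.2⟩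

end Summit.FinalStateConjecture.FinalStateConjecture.Theorems.ExactKerrEnds

end
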